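import Summits.QuantumFields.BalabanUV.Beta.CombWilsonT2EvenPairRow
import Summits.QuantumFields.BalabanUV.Beta.FP.PeriodisedWardOrderOneTower
import Summits.QuantumFields.BalabanUV.Beta.FP.TowerHSideRowsClosing

/-!
# `BalabanUV.Beta.CombWilsonA2Sector` — binder row D1 ∕ (C1), PART 76 (J-NOTE-24 §3 (X)): **THE WILSON SECTOR OF v10's SECOND-ORDER WARD ROW `a2` AT THE ROAD's LETTERS
# IS CLOSED IN THE TREE AT EVERY DEPTH** — for the road's `hT₂` display (pair-symmetrised, even-halved, second-slot-periodised Wilson bi-table) at the symmetric-block table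
# `(8N²)⁻¹ • wsym22 N` (the pin `hTW`), the law's finest form block `H₀ = (perF T (bhKStepSh 3 Lc (Dsh Lc) j))|ff` at `j = 0`, the Wilson member `(−2c) • Σ_b h b • Â_b|ff` of `H₁f`,
# and v10's generator jets `hW₀ hW₁f hW₂f` VERBATIM (any direction weight `h`):
# `((−2c)² • Σ_b Σ_{b′} (h b·h b′) • T₂ b b′) * W₀ + 2 • (((−2c) • Σ_b h b • Â_b|ff) * W₁) + H₀ * W₂ = c² • of (b e ↦ h b · (H₀ *ᵥ h) b · ψ_e(↑b.1 + e_{b.2}))`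
# — leaf-05 g43 `PeriodisedWardOrderOneTower.torus_a2_wilson_tower` BY NAME through PART 27 `T2evenPair_eq_member` and road `TowerHSideRowsClosing.perF_bhKStepSh_zero_ff_eq`

WHY (an2 g79 J-NOTE-24 `HOME/b2b-balaban-beta-an2/gen79/J24-A2-SCOPE.md` §2–§3; road FP SPEC-64 v3.4 §16 (3)(d)).  v10's `a2` (l.198) reads, at the total slot,
`LHS(v) = X(v) + M(v) + L(v)` with (X) the WILSON sector `((−2c)²•ΣΣ (hv b·hv b′)•T₂ b b′)·W₀ + 2•(((−2c)•Σ hb•Â|ff)·W₁f v) + H₀·W₂f v`, (M) the mixed sector of `H₂f` against `W₀`,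
(L) the Λ∕companion members of `H₁f` against `W₁f`.  leaf-05 g43 closed (X) for an2 g42's bi-family `H₂^{b,b′} := (perF T (dper T (W b′.2 ↑b′.1 b.2 ↑b.1)))|ff` and the ROOTED form block
`(perF T (bhKStepAt 3 ρ L 0))|ff`; v10 displays `T₂` in the road's pair-symmetrised even shape (`hT₂`) and `H₀` in the law's `bhKStepSh … (Dsh Lc)` spelling.  THIS FILE is the two-line
bridge, so that the (X) sector of `a2` is a theorem AT v10's LETTERS (modulo the pin `hTW`, exactly as (J-X₂) is by PART 27): the scope's by-value test (T1) is thereby a theorem, and the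
eventual assembly of `a2` (J-NOTE-24 §6 (F2), ONLY after the by-value test and the road's co-sign) starts from `LHS − 𝔔₀ᵀY₂ = [c²•of(h·(H₀h)·ψ(end)) + M(v) + L(v)] − 𝔔₀ᵀY₂`.
WHAT ([folklore] BY NAME; no `def`, no `def … : Prop`, nothing cited, 0 sorry; `d = 3`, ANY box `M′`, every depth `n`, rooted spelling `rs := fun _ => ctrOff 4 Lc` free as `rs`):
**`torus_a2_wilsonSector_T2evenPair`** — the display above.
WHAT THIS IS NOT: NOT `a2` (its (M) and (L) sectors and the `𝔔₀ᵀ`-term are untouched; `a2` stays a DISPLAYED HYPOTHESIS of v10, «a2 LAST», by value first — J-NOTE-24 §5 T-A2); not the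
pin `Pn.T (n+2) = (8N²)⁻¹ • wsym22 N` (instantiation ∕ referee); not (K1); nothing of Bałaban's asserted, valued or discharged; 0 estimates; 0∕4 row-D1 binders (hW, hR, D1Tel, D1Rep);
ROOT M‴ p325680 ∕ P5c ∕ D6 untouched; NOT (C1), NOT (T-ID), NOT D1, NEVER «G-an2-4 closed», NOT BetaPertH, NOT continuum, NOT Clay.

HONEST DEPENDENCY (page 1, mandatory): continuum YM on T⁴ ⇐ BetaPertH ∧ nine spine estimates (0/9 proved); BetaPertH ⇐ (D1) ∧ (D4) ∧ CAP+tail;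
G-an2-4 gates asym, D1 and NE2/3/4.  HONEST FRAMING (cell contract, verbatim): «discharging `BetaPertH` makes Bałaban's UV stability UNCONDITIONAL —
a real constructive-QFT result; it is NOT the continuum limit and NOT the Clay problem.»  ABSOLUTE RULE (cell charter, verbatim): «No internally-minted
statement may enter as a cited fact. Every hypothesis is either kernel-proved in this package or a verbatim quotation of a PUBLISHED theorem with page
reference. The manuscript(s) under audit are NOT citable for their own disputed steps — they are the thing under adjudication; programme-internal
(2001/route/tribunal) claims are never citable.»  Row D1 ∕ (C1) OWNER an2 (b2b-balaban-beta-an2) gen 79, 2026-08-29.  No existing file touched.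
-/

noncomputable section

open scoped BigOperators

namespace Summit.QuantumFields.BalabanUV.Beta.CombWilsonA2Sector

open Finset Matrix
open Literature.MathematicalPhysics.QuantumFieldTheory.Balaban1983to89
open Literature.MathematicalPhysics.QuantumFieldTheory.Balaban1983to89.Beta
open B4TorusKernel.MultiPeriod (translate)
open B6Lemma24Torus (pbox)
open ExpKernelCalculus (MKer)
open StepJetData (wilsonA)
open WilsonBiStencil (wilsonW₂)
open WilsonVertex2Sym (wsym22)
open AffineAveraging (Site unitVec)
open AveragingContoursRooted (ctrOff)
open OneStepResolventKernel (Fib)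
open Summit.QuantumFields.BalabanUV.Beta.TameKernelCalculus (trK)
open Summit.QuantumFields.BalabanUV.Beta.BorderedHessian (sgnK bhKStepAt)
open Summit.QuantumFields.BalabanUV.Beta.SymShiftedSpread (bhKStepSh)
open Summit.QuantumFields.BalabanUV.Beta.DshAn1 (Dsh)
open Summit.QuantumFields.BalabanUV.Beta.FP.KernelPeriodisationFib (Idx perF)
open Summit.QuantumFields.BalabanUV.Beta.FP.KernelPeriodisationFibLoc (dper)
open Summit.QuantumFields.BalabanUV.Beta.FP.TorusCompositeObjects (towerTorus NParam towerGen)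
open Summit.QuantumFields.BalabanUV.Beta.FP.TorusCompositeFP (evalN)
open Summit.QuantumFields.BalabanUV.Beta.CombWilsonT2EvenPairRow (T2evenPair_eq_member)
open Summit.QuantumFields.BalabanUV.Beta.FP.PeriodisedWardOrderOneTower (torus_a2_wilson_tower)
open Summit.QuantumFields.BalabanUV.Beta.FP.TowerHSideRowsClosing (perF_bhKStepSh_zero_ff_eq)

variable (Lc : ℕ) [NeZero Lc] {N : ℕ} (M' : Fin (3 + 1) → ℕ) [∀ μ, NeZero (M' μ)] (rs : ℕ → (Fin (3 + 1) → ℕ)) (n : ℕ)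

/-- [folklore] **`torus_a2_wilsonSector_T2evenPair` — THE WILSON SECTOR OF v10's `a2` AT THE ROAD's `hT₂` DISPLAY, CLOSED FORM, EVERY DEPTH** (`2 ≤ N`; `T := towerTorus Lc M′ n`;
table `(8N²)⁻¹ • wsym22 N`; `H₀` in the law's `bhKStepSh 3 Lc (Dsh Lc) j` spelling at `j = 0`; `hW₀ hW₁ hW₂` = v10's `hW₀ hW₁f hW₂f` with direction weight `h`, step constant `c`):
`((−2c)² • Σ_b Σ_{b′} (h b·h b′) • T₂ b b′) * W₀ + 2 • (((−2c) • Σ_b h b • Â_b|ff) * W₁) + H₀ * W₂ = c² • of (b e ↦ h b · (H₀ *ᵥ h) b · (evalN Lc M′ rs n (fun z => z) (↑b.1 + e_{b.2}) e))`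
— `torus_a2_wilson_tower` (leaf-05 g43) after `T2evenPair_eq_member` (PART 27) and `perF_bhKStepSh_zero_ff_eq` (road). -/
theorem torus_a2_wilsonSector_T2evenPair (hN : 2 ≤ N) (ρ : Site (3 + 1)) (c : ℝ)
    (h : ↥(pbox (towerTorus Lc M' n)) × Fin (3 + 1) → ℝ)
    {H₀ : Matrix (↥(pbox (towerTorus Lc M' n)) × Fin (3 + 1)) (↥(pbox (towerTorus Lc M' n)) × Fin (3 + 1)) ℝ} (j : ℕ) (hj : j = 0)
    (hH₀ : H₀ = (perF (towerTorus Lc M' n) (bhKStepSh 3 Lc (Dsh Lc) j)).submatrix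
        (fun b : ↥(pbox (towerTorus Lc M' n)) × Fin (3 + 1) => ((b.1, Sum.inl b.2) : Idx (towerTorus Lc M' n) (Fib 3)))
        (fun b : ↥(pbox (towerTorus Lc M' n)) × Fin (3 + 1) => ((b.1, Sum.inl b.2) : Idx (towerTorus Lc M' n) (Fib 3))))
    {W₀ : Matrix (↥(pbox (towerTorus Lc M' n)) × Fin (3 + 1)) (NParam Lc M' rs n) ℝ} (hW₀ : W₀ = towerGen Lc M' rs n)
    {W₁ : Matrix (↥(pbox (towerTorus Lc M' n)) × Fin (3 + 1)) (NParam Lc M' rs n) ℝ}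
    (hW₁ : W₁ = Matrix.of fun (b : (↥(pbox (towerTorus Lc M' n)) × Fin (3 + 1))) (e : NParam Lc M' rs n) =>
        -(c * h b * evalN Lc M' rs n (fun b' : (↥(pbox (towerTorus Lc M' n)) × Fin (3 + 1)) => (b'.1 : Site (3 + 1)) + unitVec b'.2) b e))
    {W₂ : Matrix (↥(pbox (towerTorus Lc M' n)) × Fin (3 + 1)) (NParam Lc M' rs n) ℝ}
    (hW₂ : W₂ = Matrix.of fun (b : (↥(pbox (towerTorus Lc M' n)) × Fin (3 + 1))) (e : NParam Lc M' rs n) =>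
        (c * h b) ^ 2 * evalN Lc M' rs n (fun b' : (↥(pbox (towerTorus Lc M' n)) × Fin (3 + 1)) => (b'.1 : Site (3 + 1)) + unitVec b'.2) b e)
    {T₂ : ↥(pbox (towerTorus Lc M' n)) × Fin (3 + 1) → ↥(pbox (towerTorus Lc M' n)) × Fin (3 + 1) →
        Matrix (↥(pbox (towerTorus Lc M' n)) × Fin (3 + 1)) (↥(pbox (towerTorus Lc M' n)) × Fin (3 + 1)) ℝ}
    (hT₂ : ∀ b b' : ↥(pbox (towerTorus Lc M' n)) × Fin (3 + 1), T₂ b b' = (1 / 2 : ℝ) • ((perF (towerTorus Lc M' n) (dper (towerTorus Lc M' n) (fun X Z i₁ i₂ => ∑' m : Site (3 + 1),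
              ((1 / 2 : ℝ) • (wilsonW₂ 3 ((8 * (N : ℝ) ^ 2)⁻¹ • wsym22 N) b.2 (b.1 : Site (3 + 1)) b'.2 (translate (towerTorus Lc M' n) (b'.1 : Site (3 + 1)) m)
                + sgnK (trK (wilsonW₂ 3 ((8 * (N : ℝ) ^ 2)⁻¹ • wsym22 N) b.2 (b.1 : Site (3 + 1)) b'.2 (translate (towerTorus Lc M' n) (b'.1 : Site (3 + 1)) m))))) X Z i₁ i₂))).submatrix
            (fun b : ↥(pbox (towerTorus Lc M' n)) × Fin (3 + 1) => ((b.1, Sum.inl b.2) : Idx (towerTorus Lc M' n) (Fib 3)))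
            (fun b : ↥(pbox (towerTorus Lc M' n)) × Fin (3 + 1) => ((b.1, Sum.inl b.2) : Idx (towerTorus Lc M' n) (Fib 3)))
        + (perF (towerTorus Lc M' n) (dper (towerTorus Lc M' n) (fun X Z i₁ i₂ => ∑' m : Site (3 + 1),
              ((1 / 2 : ℝ) • (wilsonW₂ 3 ((8 * (N : ℝ) ^ 2)⁻¹ • wsym22 N) b'.2 (b'.1 : Site (3 + 1)) b.2 (translate (towerTorus Lc M' n) (b.1 : Site (3 + 1)) m)
                + sgnK (trK (wilsonW₂ 3 ((8 * (N : ℝ) ^ 2)⁻¹ • wsym22 N) b'.2 (b'.1 : Site (3 + 1)) b.2 (translate (towerTorus Lc M' n) (b.1 : Site (3 + 1)) m))))) X Z i₁ i₂))).submatrix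
            (fun b : ↥(pbox (towerTorus Lc M' n)) × Fin (3 + 1) => ((b.1, Sum.inl b.2) : Idx (towerTorus Lc M' n) (Fib 3)))
            (fun b : ↥(pbox (towerTorus Lc M' n)) × Fin (3 + 1) => ((b.1, Sum.inl b.2) : Idx (towerTorus Lc M' n) (Fib 3)))))
    {H₁ : Matrix (↥(pbox (towerTorus Lc M' n)) × Fin (3 + 1)) (↥(pbox (towerTorus Lc M' n)) × Fin (3 + 1)) ℝ}
    (hH₁ : H₁ = ((-2 : ℝ) * c) • ∑ b : ↥(pbox (towerTorus Lc M' n)) × Fin (3 + 1), h b •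
        (perF (towerTorus Lc M' n) (dper (towerTorus Lc M' n) (wilsonA 3 b.2 (b.1 : Site (3 + 1))))).submatrix
          (fun b : ↥(pbox (towerTorus Lc M' n)) × Fin (3 + 1) => ((b.1, Sum.inl b.2) : Idx (towerTorus Lc M' n) (Fib 3)))
          (fun b : ↥(pbox (towerTorus Lc M' n)) × Fin (3 + 1) => ((b.1, Sum.inl b.2) : Idx (towerTorus Lc M' n) (Fib 3))))
    {H₂ : Matrix (↥(pbox (towerTorus Lc M' n)) × Fin (3 + 1)) (↥(pbox (towerTorus Lc M' n)) × Fin (3 + 1)) ℝ}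
    (hH₂ : H₂ = ((-2 : ℝ) * c) ^ 2 •
        ∑ b : ↥(pbox (towerTorus Lc M' n)) × Fin (3 + 1), ∑ b' : ↥(pbox (towerTorus Lc M' n)) × Fin (3 + 1), (h b * h b') • T₂ b b') :
    H₂ * W₀ + (2 : ℝ) • (H₁ * W₁) + H₀ * W₂
      = c ^ 2 • Matrix.of (fun (v : ↥(pbox (towerTorus Lc M' n)) × Fin (3 + 1)) (e : NParam Lc M' rs n) =>
          h v * H₀.mulVec h v * evalN Lc M' rs n (fun z : Site (3 + 1) => z) ((v.1 : Site (3 + 1)) + unitVec v.2) e) := by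
  -- an2 g42's bi-family at the symmetric-block table (PART 27's `hW` letter)
  set W : Fin (3 + 1) → Site (3 + 1) → Fin (3 + 1) → Site (3 + 1) → MKer (3 + 1) (Fib 3) :=
    fun κ' u' κ u x z a e => ∑' m : Site (3 + 1), wilsonW₂ 3 ((8 * (N : ℝ) ^ 2)⁻¹ • wsym22 N) κ u κ' (translate (towerTorus Lc M' n) u' m) x z a e with hW
  -- the road's display IS the bi-family member (PART 27), so `H₂` has leaf-05's shape
  have hH₂' : H₂ = ((-2 : ℝ) * c) ^ 2 •
      ∑ b : ↥(pbox (towerTorus Lc M' n)) × Fin (3 + 1), ∑ b' : ↥(pbox (towerTorus Lc M' n)) × Fin (3 + 1), (h b * h b') •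
        (perF (towerTorus Lc M' n) (dper (towerTorus Lc M' n) (W b'.2 (b'.1 : Site (3 + 1)) b.2 (b.1 : Site (3 + 1))))).submatrix
          (fun c : ↥(pbox (towerTorus Lc M' n)) × Fin (3 + 1) => ((c.1, Sum.inl c.2) : Idx (towerTorus Lc M' n) (Fib 3)))
          (fun c : ↥(pbox (towerTorus Lc M' n)) × Fin (3 + 1) => ((c.1, Sum.inl c.2) : Idx (towerTorus Lc M' n) (Fib 3))) := by
    rw [hH₂]
    refine congrArg _ (Finset.sum_congr rfl fun b _ => Finset.sum_congr rfl fun b' _ => ?_)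
    rw [T2evenPair_eq_member (towerTorus Lc M' n) hW hT₂ b b']
  -- the law's form block at `j = 0` IS the rooted form block (road)
  have hH₀' : H₀ = (perF (towerTorus Lc M' n) (bhKStepAt 3 ρ Lc 0)).submatrix
      (fun b : ↥(pbox (towerTorus Lc M' n)) × Fin (3 + 1) => ((b.1, Sum.inl b.2) : Idx (towerTorus Lc M' n) (Fib 3)))
      (fun b : ↥(pbox (towerTorus Lc M' n)) × Fin (3 + 1) => ((b.1, Sum.inl b.2) : Idx (towerTorus Lc M' n) (Fib 3))) := by
    rw [hH₀, perF_bhKStepSh_zero_ff_eq Lc n M' ρ j hj]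
  exact torus_a2_wilson_tower Lc M' rs n ρ Lc c h hH₀' hW₀ hW₁ hW₂ hH₁ hN hW hH₂'

end Summit.QuantumFields.BalabanUV.Beta.CombWilsonA2Sector

end
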